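import Literature.AlgebraicGeometry.AbelianSchemes.PoincareFamilyPointsInjective
import Literature.AlgebraicGeometry.Modules.RankOneTrivialOfSurjectivePullback
import HarnessLib

/-!
# A `T`-point of `Â = A⁄K(L)` over which the Poincaré family is trivial — or merely acquires a section generating on a
# sub-object `T₀ ↠ T` — is the point over which it is KNOWN to be trivial ([MumfordAV1970] §13, proof of the Theorem)

Layer `Literature/AlgebraicGeometry/AbelianSchemes`, namespace `Literature.AlgebraicGeometry.AbelianSchemes.AbelianSchemeOver`.  THEOREMS ONLY
(no definition, no named fact, no instance, no notation, no `sorry`).  Cell `hodgecm-mathlib` (D-0151), brick (c-geom-1) of the «H1-DIM-ANY-CHAR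
cut» (B-p04 memo v2∕v3): the GEOMETRIC half of [MumfordAV1970] §13 pp. 127–129 «if the representing module `Q` were not `k`, `P` would be
trivial over `X × Spec(R∕J)` for a thickening `Spec(R∕J) ⊋ Spec k` of `0̂`, contradicting the injectivity of `ŷ ↦ P_ŷ`», in the tree's
currency and WITHOUT `k[ε]`: ★ `eq_of_nonempty_pullback_poincare_iso` detects points of `Â` by `𝒫` on ALL test objects `T`, so the
thickening may be ANY `T` receiving a SURJECTIVE `j : T₀ → T` (e.g. `Spec κ ↪ Spec (R∕J)`, `J ⊇ 𝔪ⁿ`).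

Standing data (★ `PoincareFamilyPointsInjective` §3): `S` locally Noetherian, `A, Â` abelian schemes over `S`, `π : A → Â` a flat surjective
homomorphism with kernel clause `hker` («`u ≫ π = 1 ↔ u ∈ K(L)(T)`»), `L` rank one rigidified along the unit section (`hε`), `𝒫` on `A ×_S Â`
with the socket `(1 × π)^*𝒫 ≅ Λ(L)` (`hsock`).

* §0 `isPullback_whiskerLeft_left_over`, `surjective_whiskerLeft_left` — `1_A × j : A ×_S T₀ → A ×_S T` is a base change of `j`, hence
  surjective when `j` is.
* §1 **`eq_of_nonempty_pullback_poincare_iso_unitModule`** — two `T`-points `g, e` of `Â` with `(1 × g)^*𝒫 ≅ 𝒪` and `(1 × e)^*𝒫 ≅ 𝒪` are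
  EQUAL (★ points-injectivity).
* §2 **`eq_of_isUnit_pullback_section_poincare`** — if `(1 × e)^*𝒫 ≅ 𝒪` and `(1 × g)^*𝒫` (rank one, `hP1`) has a global section `σ` whose
  pull-back along the surjective `1 × j : A ×_S T₀ → A ×_S T` becomes a UNIT under some trivialisation `φ₀` of `(1 × j)^*(1 × g)^*𝒫`, then
  `g = e`: ★ B5(b) `nonempty_iso_unitModule_of_isUnit_pullback_section` makes `(1 × g)^*𝒫` trivial, and §1 applies.  (Consumer: `T = Spec (R∕J)`
  an infinitesimal neighbourhood of `0̂`, `T₀ = Spec κ`, `e` = the constant point at `0̂`, `σ` a lift of the generator of `Γ(A_κ, 𝒪) = κ` — then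
  `Spec (R∕J) → Â` is constant, i.e. `𝔪 ⊆ J`.)

HC_CM is proved only modulo the 7 printed citations until rung 0 closes; nothing here bears on a summit statement (count-neutral capital).

## References
* [MumfordAV1970] D. Mumford, *Abelian Varieties* (1970), §13, the Theorem and its proof (pp. 125–130).
* [MumfordFogartyKirwan1994] D. Mumford, J. Fogarty, F. Kirwan, *GIT*, 3rd ed. (1994), Ch. 6 §2 Def. 6.2 (p. 120).
* [GortzWedhorn2020] U. Görtz, T. Wedhorn, *Algebraic Geometry I*, 2nd ed. (2020), Section (4.7) (pp. 107–108) (base change), Prop. 4.16 (p. 101).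
* [StacksProject] The Stacks Project, Tag 01B8 (Nakayama for sheaves), Tag 02VW.
-/

set_option autoImplicit false

noncomputable section

-- `(A.X ⊗ T).left = pullback A.X.hom T.hom` and friends hold by `rfl` only.
set_option backward.isDefEq.respectTransparency false

open CategoryTheory CategoryTheory.Limits AlgebraicGeometry MonoidalCategory CartesianMonoidalCategory

open scoped MonObj

namespace Literature.AlgebraicGeometry.AbelianSchemes

namespace AbelianSchemeOver

open Literature.AlgebraicGeometry.Motives Literature.AlgebraicGeometry.Modules

/-! ## §0 `1_A × j` is a base change of `j` -/

section Whisker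

variable {S : Scheme.{0}} (A : AbelianSchemeOver S) {T₀ T : Over S} (j : T₀ ⟶ T)

/-- **`(A ×_S T₀ → A ×_S T)` is the base change of `T₀ → T`** along the projection `A ×_S T → T` (any base `S`).
[cite: GortzWedhorn2020, Section (4.7) (pp. 107–108)] -/
theorem isPullback_whiskerLeft_left_over :
    IsPullback (A.X ◁ j).left (pullback.snd A.X.hom T₀.hom) (pullback.snd A.X.hom T.hom) j.left := by
  refine IsPullback.of_right ?_ (Over.whiskerLeft_left_snd j) (IsPullback.of_hasPullback A.X.hom T.hom)
  rw [Over.whiskerLeft_left_fst, Over.w j]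
  exact IsPullback.of_hasPullback A.X.hom T₀.hom

/-- **`1_A × j` is surjective when `j` is** (surjectivity is stable under base change). [cite: GortzWedhorn2020, Prop. 4.16 (p. 101)] -/
theorem surjective_whiskerLeft_left [Surjective j.left] : Surjective (A.X ◁ j).left :=
  MorphismProperty.of_isPullback (P := @Surjective) (A.isPullback_whiskerLeft_left_over j).flip inferInstance

end Whisker

/-! ## §1 Two points over which `𝒫` is trivial coincide -/

section Points

variable {S : Scheme.{0}} [IsLocallyNoetherian S] (A hat : AbelianSchemeOver S) (π : A.X ⟶ hat.X) [IsMonHom π]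
  [Flat π.left] [Surjective π.left]
  {L : A.left.Modules} (hL : HasRank L 1)
  (hε : CechPic.pullback A.unitSection (detClass (HasRank.isFiniteLocallyFree' hL)) = 1)
  (hker : ∀ (T : Over S) (u : T ⟶ A.X), u ≫ π = 1 ↔ A.MemKOfL L u)
  (P : (A.prodLeft hat).Modules)
  (hsock : Nonempty ((Scheme.Modules.pullback (A.X ◁ π).left).obj P ≅ A.mumfordBundle L))

include hε hker hsock in
/-- **Two `T`-points of `Â` over which `𝒫` is TRIVIAL are equal**: `(1 × g)^*𝒫 ≅ 𝒪 ≅ (1 × e)^*𝒫 ⇒ g = e` (★ `eq_of_nonempty_pullback_poincare_iso`).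
[cite: MumfordAV1970, §13 (the Theorem and its proof, pp. 125–130)] -/
theorem eq_of_nonempty_pullback_poincare_iso_unitModule {T : Over S} (g e : T ⟶ hat.X)
    (hg : Nonempty ((Scheme.Modules.pullback (A.X ◁ g).left).obj P ≅ unitModule (A.X ⊗ T).left))
    (he : Nonempty ((Scheme.Modules.pullback (A.X ◁ e).left).obj P ≅ unitModule (A.X ⊗ T).left)) : g = e := by
  refine A.eq_of_nonempty_pullback_poincare_iso hat π hL hε hker P hsock g e ⟨?_⟩
  exact (Scheme.Modules.pullbackCongr (A.baseChangeToProd_eq_whiskerLeft_left hat g)).app P ≪≫ hg.some ≪≫ he.some.symm ≪≫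
    ((Scheme.Modules.pullbackCongr (A.baseChangeToProd_eq_whiskerLeft_left hat e)).app P).symm

include hε hker hsock in
/-- **A `T`-point `g` of `Â` over which `𝒫` has a section that GENERATES after pull-back along a surjective `j : T₀ → T` is the trivialising
point `e`** ([MumfordAV1970] §13 pp. 127–129, the step «`P` trivial on `X × Spec(R∕J)` ⇒ the point is constant», any test object): `(1 × e)^*𝒫 ≅ 𝒪`,
`𝒫` of rank one, `σ ∈ Γ(A ×_S T, (1 × g)^*𝒫)` with `φ₀(η σ)` a global unit for some trivialisation `φ₀` of `(1 × j)^*(1 × g)^*𝒫`; then `g = e`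
(★ B5(b) `nonempty_iso_unitModule_of_isUnit_pullback_section` + §1).
[cite: MumfordAV1970, §13 (the Theorem and its proof, pp. 125–130)] [cite: StacksProject, Tag 01B8 (Lemma 17.9.4)] -/
theorem eq_of_isUnit_pullback_section_poincare (hP1 : HasRank P 1) {T₀ T : Over S} (j : T₀ ⟶ T) [Surjective j.left] (g e : T ⟶ hat.X)
    (he : Nonempty ((Scheme.Modules.pullback (A.X ◁ e).left).obj P ≅ unitModule (A.X ⊗ T).left))
    (σ : Γ((Scheme.Modules.pullback (A.X ◁ g).left).obj P, ⊤))
    (φ₀ : (Scheme.Modules.pullback (A.X ◁ j).left).obj ((Scheme.Modules.pullback (A.X ◁ g).left).obj P) ≅ unitModule (A.X ⊗ T₀).left)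
    (hu : IsUnit (M := Γ((A.X ⊗ T₀).left, ⊤))
      (φ₀.hom.app ⊤ (Literature.AlgebraicGeometry.Modules.unitSection (A.X ◁ j).left ((Scheme.Modules.pullback (A.X ◁ g).left).obj P) ⊤ σ))) : g = e := by
  haveI : Surjective (A.X ◁ j).left := A.surjective_whiskerLeft_left j
  have hg : Nonempty ((Scheme.Modules.pullback (A.X ◁ g).left).obj P ≅ unitModule (A.X ⊗ T).left) :=
    nonempty_iso_unitModule_of_isUnit_pullback_section (hasRank_pullback _ hP1) σ (A.X ◁ j).left φ₀ hu
  exact A.eq_of_nonempty_pullback_poincare_iso_unitModule hat π hL hε hker P hsock g e hg he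

end Points

end AbelianSchemeOver

end Literature.AlgebraicGeometry.AbelianSchemes

end
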